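import Literature.Computability.Complexity.OccurrenceObstructionsBIP
import Literature.Computability.AlgebraicComplexity.OrbitClosureProofs
import HarnessLib

/-!
# The two padded permanents of the tree are degenerations of one another
(BIP's `X₁₁^{n-m} per_m` versus the fresh-variable padding), proved

Topic `Literature/Computability/AlgebraicComplexity`; provefact unit
`Literature.CplxAlg.bip_no_occurrence_obstruction` (`BIPNoOccurrence.lean`). That fact renders
Bürgisser–Ikenmeyer–Panova's "no occurrence obstructions" theorem (J. AMS 32 (2019),
arXiv:1604.06431v3 Thm. 1.4) for the tree's padded permanent
`paddedPerPoly k m n = X₀₀^{n-m} · per_m(bottom-right block)`, whose padding variable is NOT a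
variable of `per_m`, whereas BIP's `Z_{n,m}` is the orbit closure of `X₁₁^{n-m} per_m` with `X₁₁`
a variable of `per_m` (§1(a), (1.2)); the discrepancy, and the theorem as printed
(`Literature.Computability.Complexity.bip2019_not_hasOccurrenceObstruction` over `Literature.Computability.Complexity.bipPaddedPerPoly`,
top-left block, padding by its corner variable), are recorded in
`Literature/Computability/Complexity/OccurrenceObstructionsBIP.lean`, whose module docstring
argues in prose that BIP's orbit closure is contained in the tree's and not conversely. This
file PROVES the geometry relating the two paddings (letters as in `BIPNoOccurrence.lean`:
`m` = permanent size, `n` = matrix size):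

* `bipPaddedPerPoly_mem_endOrbit_paddedPerPoly`: BIP's padded permanent is the image of the
  tree's under the (non-injective) renaming of variables by the block shift `i ↦ i - (n-m)`
  (`rename_mem_endOrbit`: every renaming is a linear substitution), hence over an infinite field
  `Δ[bipPaddedPerPoly] ⊆ Δ[paddedPerPoly]` (`orbitClosure_bipPaddedPerPoly_subset`);
* `paddedPerPoly_mem_endOrbit_bipPaddedPerPoly_succ`: conversely the tree's padded `per_m` is a
  degeneration of BIP's padded `per_{m+1}` — zero the first row and column of the
  `(m+1)`-block off its corner (`collapseSubst`); by the one-term Laplace factorisation of a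
  permanent (`permanent_eq_mul_of_row_eq_zero`, not in Mathlib) `per_{m+1} ↦ X₀₀ · per_m` of the
  complementary block, which is then moved to the bottom-right — hence
  `paddedPerPoly k m n ∈ Δ[bipPaddedPerPoly k (m+1) n]` (`paddedPerPoly_mem_orbitClosure_bipPaddedPerPoly_succ`);
* consequently (`not_hasOccurrenceObstruction_paddedPerPoly_of_succ`), granted the standard
  monotonicity of occurrence under degeneration over `ℂ`
  (`hasOccurrenceObstruction_of_mem_orbitClosure_complex`, a named fact: restriction
  epimorphism plus complete reducibility, BIP §1(a)), the PRINTED theorem at permanent size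
  `m + 1` yields the tree's fresh-padding statement for `n ≥ (m+1)²⁵` — the same threshold that
  `OccurrenceObstructionsBIP.lean` reaches by re-running BIP's assembly with `ℓ(λ) ≤ m² + 1`
  (`Literature.Computability.Complexity.no_occurrence_obstructions_succ_of_parts`); neither route gives the tree's threshold
  `n ≥ m²⁵`.

## References

* P. Bürgisser, C. Ikenmeyer, G. Panova, *No occurrence obstructions in geometric complexity
  theory*, J. AMS 32 (2019) 163–193 = arXiv:1604.06431v3, §1(a) (the two padding conventions:
  "Sometimes the padding is achieved by using a variable not appearing in `per_m`, but this is
  irrelevant, cf. [IP17]"), Thm. 1.4.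
* C. Ikenmeyer, G. Panova, *Rectangular Kronecker coefficients and plethysms in geometric
  complexity theory*, Adv. Math. 319 (2017), §7 Appendix (padding with the first variable).
* H. Minc, *Permanents*, Encyclopedia Math. Appl. 6 (1978), §1.1 (Laplace expansion).
-/

noncomputable section

open MvPolynomial

namespace Literature.Computability.AlgebraicComplexity

variable {k : Type*} [Field k]

/-! #### BIP's padded permanent is a degeneration of the tree's `paddedPerPoly` -/

/-- Renaming variables along an arbitrary map `r : σ → σ` (not necessarily injective) is the linear
substitution by the `0/1` matrix of `r`, hence `rename r f` lies in the endomorphism orbit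
`End(k^σ) · f`. [Mulmuley–Sohoni 2001, §4; Landsberg 2017, §1.2] [folklore] -/
theorem rename_mem_endOrbit {σ : Type*} [Fintype σ] [DecidableEq σ] (r : σ → σ)
    (f : MvPolynomial σ k) : rename r f ∈ endOrbit σ k f := by
  refine ⟨Matrix.of fun j i => if j = r i then (1 : k) else 0, ?_⟩
  suffices h : linSubst σ k (Matrix.of fun j i => if j = r i then (1 : k) else 0) =
      (rename r : MvPolynomial σ k →ₐ[k] MvPolynomial σ k) from
    congrArg (fun φ : MvPolynomial σ k →ₐ[k] MvPolynomial σ k => φ f) h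
  apply MvPolynomial.algHom_ext
  intro i
  simp [linSubst_X, rename_X, Matrix.of_apply, ite_smul]

/-- The shift `i ↦ i - (n - m)` (truncated subtraction) on `Fin n`: it fixes `0` and maps the
bottom-right block `{i // n - m ≤ i}` bijectively onto the top-left block `{i // i < m}`
(`padBlockShiftEquiv`). [folklore] -/
def padBlockShift (m n : ℕ) (i : Fin n) : Fin n :=
  ⟨(i : ℕ) - (n - m), lt_of_le_of_lt (Nat.sub_le _ _) i.2⟩

/-- Value of `padBlockShift`. [folklore] -/
@[simp] theorem padBlockShift_val (m n : ℕ) (i : Fin n) :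
    (padBlockShift m n i : ℕ) = (i : ℕ) - (n - m) :=
  rfl

/-- `padBlockShift` as a bijection from the bottom-right block `BlockIdx m n` onto the top-left block
`TopBlockIdx m n` (inverse `j ↦ j + (n - m)`; no hypothesis `m ≤ n` is needed). [folklore] -/
def padBlockShiftEquiv (m n : ℕ) : BlockIdx m n ≃ Complexity.TopBlockIdx m n where
  toFun i := ⟨padBlockShift m n i.1, by
    have h1 := i.2
    have h2 := i.1.2
    simp only [padBlockShift_val]
    omega⟩
  invFun j := ⟨⟨(j : ℕ) + (n - m), by have := j.2; have := j.1.2; omega⟩, by simp⟩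
  left_inv i := by
    apply Subtype.ext
    apply Fin.ext
    have := i.2
    simp only [padBlockShift_val]
    omega
  right_inv j := by
    apply Subtype.ext
    apply Fin.ext
    simp only [padBlockShift_val]
    omega

/-- Renaming all variables by the block shift (in both indices) turns the tree's padded permanent
`X₀₀^{n-m} · per_m(bottom-right block)` into BIP's `X₀₀^{n-m} · per_m(top-left block)`: the
padding variable `X₀₀` is fixed and the block is translated onto the top-left block, which
contains `(0,0)`. [Bürgisser–Ikenmeyer–Panova 2019, §1.1 ("padding … by a variable not appearing
in `per_m`" vs `X₁₁`)] [folklore] -/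
theorem rename_padBlockShift_paddedPerPoly (m n : ℕ) [NeZero n] :
    rename (Prod.map (padBlockShift m n) (padBlockShift m n)) (paddedPerPoly k m n) =
      Complexity.bipPaddedPerPoly k m n := by
  have h0 : Prod.map (padBlockShift m n) (padBlockShift m n) ((0 : Fin n), (0 : Fin n)) = (0, 0) := by
    ext <;> simp
  have hcomp : (Prod.map (padBlockShift m n) (padBlockShift m n)) ∘
      (fun ij : BlockIdx m n × BlockIdx m n => ((ij.1 : Fin n), (ij.2 : Fin n))) =
      (fun ij : Complexity.TopBlockIdx m n × Complexity.TopBlockIdx m n => ((ij.1 : Fin n), (ij.2 : Fin n))) ∘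
        Prod.map (padBlockShiftEquiv m n) (padBlockShiftEquiv m n) := by
    funext ij
    rfl
  rw [paddedPerPoly, map_mul, map_pow, rename_X, h0, rename_rename, hcomp, ← rename_rename,
    rename_perPoly_equiv (padBlockShiftEquiv m n)]
  rfl

/-- BIP's padded permanent lies in the endomorphism orbit `End(k^{n²}) · (X₀₀^{n-m} per_m)` of the
tree's padded permanent (substitute for the variables by the non-injective block shift). Over `ℂ`
(`endOrbit_subset_orbitClosure`, `orbitClosure_subset_of_mem`) this gives
`Z_{n,m} = Δ[bipPaddedPerPoly ℂ m n] ⊆ Δ[paddedPerPoly ℂ m n]`; the reverse containment is false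
for `1 ≤ m < n` (`m²` versus `m² + 1` essential variables). [Bürgisser–Ikenmeyer–Panova 2019,
§1.1; Kadish–Landsberg 2014] [folklore] -/
theorem bipPaddedPerPoly_mem_endOrbit_paddedPerPoly (m n : ℕ) [NeZero n] :
    Complexity.bipPaddedPerPoly k m n ∈ endOrbit (Fin n × Fin n) k (paddedPerPoly k m n) := by
  rw [← rename_padBlockShift_paddedPerPoly]
  exact rename_mem_endOrbit _ _


/-! #### Conversely: the tree's padded `per_m` is a degeneration of BIP's padded `per_{m+1}` -/

section Collapse

open Equiv in
/-- Laplace-type factorisation of the permanent along a row with a single (diagonal) nonzero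
entry: if `M a j = 0` for all `j ≠ a` then `per M = M a a · per (M with row and column a
deleted)` (the one-term case of the Laplace expansion of a permanent along a row; e.g. H. Minc,
*Permanents*, Encyclopedia Math. Appl. 6, 1978). Not in Mathlib (`Matrix.permanent` has no
expansion lemmas). [folklore] -/
theorem permanent_eq_mul_of_row_eq_zero {ι R : Type*} [DecidableEq ι] [Fintype ι]
    [CommSemiring R] (M : Matrix ι ι R) (a : ι) (h : ∀ j, j ≠ a → M a j = 0) :
    M.permanent =
      M a a * (M.submatrix (Subtype.val : {i // i ≠ a} → ι) Subtype.val).permanent := by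
  unfold Matrix.permanent
  have hvan : ∀ σ : Perm ι, σ a ≠ a → ∏ i, M (σ i) i = 0 := by
    intro σ hσ
    apply Finset.prod_eq_zero (Finset.mem_univ (σ.symm a))
    rw [Equiv.apply_symm_apply]
    refine h _ fun h' => hσ ?_
    calc σ a = σ (σ.symm a) := by rw [h']
      _ = a := σ.apply_symm_apply a
  -- the bijection `Perm {i // i ≠ a} ≃ {σ : Perm ι // σ a = a}`
  let e : Perm {i // i ≠ a} ≃ {σ : Perm ι // σ a = a} :=
    (Perm.subtypeEquivSubtypePerm (· ≠ a)).trans (Equiv.subtypeEquivRight fun σ => by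
      constructor
      · intro H; exact H a (fun hh => hh rfl)
      · intro H b hb
        have hb' : b = a := not_ne_iff.mp hb
        subst hb'
        exact H)
  calc ∑ σ : Perm ι, ∏ i, M (σ i) i
      = ∑ σ : Perm ι, if σ a = a then ∏ i, M (σ i) i else 0 := by
        refine Finset.sum_congr rfl fun σ _ => ?_
        split_ifs with hσ
        · rfl
        · exact hvan σ hσ
    _ = ∑ σ ∈ Finset.univ.filter (fun σ : Perm ι => σ a = a), ∏ i, M (σ i) i :=
        (Finset.sum_filter _ _).symm
    _ = ∑ τ : {σ : Perm ι // σ a = a}, ∏ i, M (τ.1 i) i :=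
        Finset.sum_subtype _ (by simp) _
    _ = ∑ π : Perm {i // i ≠ a}, M a a * ∏ i : {i // i ≠ a}, M (π i : ι) (i : ι) := by
        refine (Fintype.sum_equiv e
          (fun π : Perm {i // i ≠ a} => M a a * ∏ i : {i // i ≠ a}, M (π i : ι) (i : ι))
          (fun τ : {σ : Perm ι // σ a = a} => ∏ i : ι, M ((τ.1 : Perm ι) i) i) fun π => ?_).symm
        have he : ((e π).1 : Perm ι) = Perm.ofSubtype π := rfl
        rw [he, ← Finset.mul_prod_erase Finset.univ _ (Finset.mem_univ a),
          Perm.ofSubtype_apply_of_not_mem π (a := a) (fun hh => hh rfl)]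
        congr 1
        rw [Finset.prod_subtype (F := inferInstance) (Finset.univ.erase a) (p := (· ≠ a))
          (fun i => by simp [Finset.mem_erase])]
        refine Fintype.prod_congr _ _ fun i => ?_
        rw [Perm.ofSubtype_apply_coe]
    _ = M a a * ∑ π : Perm {i // i ≠ a},
          ∏ i, (M.submatrix (Subtype.val : {i // i ≠ a} → ι) Subtype.val) (π i) i := by
        rw [Finset.mul_sum]
        rfl


/-- Evaluating the generic permanent: `aeval g per = per (g (i, j))`. [Bürgisser 2000, (2.2)]
[folklore] -/
theorem aeval_perPoly {ι A : Type*} [Fintype ι] [DecidableEq ι] [CommRing A] [Algebra k A]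
    (g : ι × ι → A) : aeval g (perPoly ι k) = (Matrix.of fun i j : ι => g (i, j)).permanent := by
  simp [perPoly, Matrix.permanent, map_sum, map_prod]

/-- Renaming the generic permanent along `F × F` gives the permanent of the matrix
`(X (F i, F j))ᵢⱼ`. [Bürgisser 2000, (2.2)] [folklore] -/
theorem rename_prodMap_perPoly_eq {ι τ : Type*} [Fintype ι] [DecidableEq ι] (F : ι → τ) :
    rename (Prod.map F F) (perPoly ι k) =
      (Matrix.of fun i j : ι => (X (F i, F j) : MvPolynomial (τ × τ) k)).permanent := by
  simp [perPoly, Matrix.permanent, map_sum, map_prod]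

/-- A substitution sending every variable to a variable or to `0` ("partial renaming") is a linear
substitution, so its value on `f` lies in the endomorphism orbit `End(k^σ) · f`.
[Mulmuley–Sohoni 2001, §4] [folklore] -/
theorem aeval_partialRename_mem_endOrbit {σ : Type*} [Fintype σ] [DecidableEq σ] (P : σ → Prop)
    [DecidablePred P] (r : σ → σ) (f : MvPolynomial σ k) :
    aeval (fun i => if P i then (X (r i) : MvPolynomial σ k) else 0) f ∈ endOrbit σ k f := by
  refine ⟨Matrix.of fun j i => if P i ∧ j = r i then (1 : k) else 0, ?_⟩
  suffices h : linSubst σ k (Matrix.of fun j i => if P i ∧ j = r i then (1 : k) else 0) =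
      aeval (fun i => if P i then (X (r i) : MvPolynomial σ k) else 0) from
    congrArg (fun φ : MvPolynomial σ k →ₐ[k] MvPolynomial σ k => φ f) h
  apply MvPolynomial.algHom_ext
  intro i
  by_cases hP : P i
  · simp [linSubst_X, Matrix.of_apply, hP, ite_smul]
  · simp [linSubst_X, Matrix.of_apply, hP]

variable (k)

/-- Index part of the collapsing substitution: `0 ↦ 0` and `i ↦ i + (n - (m+1))` for
`1 ≤ i ≤ m` (capped at `n - 1` for larger `i`, a junk range). [folklore] -/
def collapseIdx (m n : ℕ) [NeZero n] (i : Fin n) : Fin n :=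
  if (i : ℕ) = 0 then 0 else ⟨min ((i : ℕ) + (n - (m + 1))) (n - 1), by have := i.2; omega⟩

/-- The collapsing substitution: `X_{ab} ↦ X_{00}` if `a = b = 0`, `↦ 0` if exactly one of `a, b`
is `0`, and `↦ X_{a + (n-m-1), b + (n-m-1)}` if `a, b ≥ 1`. On the top-left `(m+1) × (m+1)`
block it zeroes the first row and column off the corner and translates the complementary
`m × m` block `{1,…,m}²` onto the bottom-right block. [folklore] -/
def collapseSubst (m n : ℕ) [NeZero n] (v : Fin n × Fin n) : MvPolynomial (Fin n × Fin n) k :=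
  if ((v.1 : ℕ) = 0 ↔ (v.2 : ℕ) = 0) then X (collapseIdx m n v.1, collapseIdx m n v.2) else 0

variable {k}

/-- The corner index `0` of the top-left `(m+1) × (m+1)` block. [folklore] -/
def topBlockCorner (m n : ℕ) [NeZero n] : Complexity.TopBlockIdx (m + 1) n :=
  ⟨0, by simp⟩

/-- Non-corner indices of the top-left block have nonzero value. [folklore] -/
theorem val_ne_zero_of_ne_topBlockCorner {m n : ℕ} [NeZero n] {b : Complexity.TopBlockIdx (m + 1) n}
    (hb : b ≠ topBlockCorner m n) : ((b : Fin n) : ℕ) ≠ 0 := fun hh =>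
  hb (Subtype.ext (Fin.ext (by simp [topBlockCorner, hh])))

/-- For `m + 1 ≤ n`, the non-corner indices `{1, …, m}` of the top-left `(m+1)`-block correspond
to the bottom-right `m`-block `{n-m, …, n-1}` by `i ↦ i + (n - (m+1))`. [folklore] -/
def topBlockSuccEquiv {m n : ℕ} [NeZero n] (h : m + 1 ≤ n) :
    {b : Complexity.TopBlockIdx (m + 1) n // b ≠ topBlockCorner m n} ≃ BlockIdx m n where
  toFun b := ⟨⟨((b.1 : Fin n) : ℕ) + (n - (m + 1)), by have h1 := b.1.2; omega⟩, by
      have h2 : ((b.1 : Fin n) : ℕ) ≠ 0 := val_ne_zero_of_ne_topBlockCorner b.2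
      simp only
      omega⟩
  invFun i := ⟨⟨⟨(i : ℕ) - (n - (m + 1)), by have := i.1.2; omega⟩, by
      have h1 := i.2; have h2 := i.1.2; simp only; omega⟩, by
      intro hh
      have h1 := i.2
      have h3 := congrArg (fun x : Complexity.TopBlockIdx (m + 1) n => ((x : Fin n) : ℕ)) hh
      simp [topBlockCorner] at h3
      omega⟩
  left_inv b := by
    apply Subtype.ext; apply Subtype.ext; apply Fin.ext
    simp
  right_inv i := by
    apply Subtype.ext; apply Fin.ext
    have h1 := i.2
    simp only
    omega

/-- On non-corner block indices the collapsing index map is the translation onto the bottom-right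
block. [folklore] -/
theorem collapseIdx_eq {m n : ℕ} [NeZero n] (h : m + 1 ≤ n)
    (a : {b : Complexity.TopBlockIdx (m + 1) n // b ≠ topBlockCorner m n}) :
    collapseIdx m n (a.1 : Fin n) = ((topBlockSuccEquiv h a : BlockIdx m n) : Fin n) := by
  have h2 : ((a.1 : Fin n) : ℕ) ≠ 0 := val_ne_zero_of_ne_topBlockCorner a.2
  have h1 := a.1.2
  apply Fin.ext
  simp only [collapseIdx, h2, if_false]
  show min _ _ = ((a.1 : Fin n) : ℕ) + (n - (m + 1))
  omega

/-- **Degeneration** `per_{m+1} ⇝ X₀₀ · per_m`: applying the collapsing substitution to BIP's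
padded permanent of size `m + 1` yields the tree's padded permanent of size `m` (for
`m + 1 ≤ n`): the first row of the block of `per_{m+1}` is zeroed off the corner, so by the
Laplace factorisation `per_{m+1} ↦ X₀₀ · per_m({1,…,m}²)`, and the latter block is moved to the
bottom-right. [Bürgisser–Ikenmeyer–Panova 2019, §1.1 (two padding conventions)] [folklore] -/
theorem aeval_collapseSubst_bipPaddedPerPoly {m n : ℕ} [NeZero n] (h : m + 1 ≤ n) :
    aeval (collapseSubst k m n) (Complexity.bipPaddedPerPoly k (m + 1) n) = paddedPerPoly k m n := by
  have h00 : collapseSubst k m n ((0 : Fin n), (0 : Fin n)) = X (0, 0) := by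
    simp [collapseSubst, collapseIdx]
  -- the matrix of substituted block variables and its Laplace factorisation
  set N : Matrix (Complexity.TopBlockIdx (m + 1) n) (Complexity.TopBlockIdx (m + 1) n) (MvPolynomial (Fin n × Fin n) k) :=
    Matrix.of fun a b => collapseSubst k m n ((a : Fin n), (b : Fin n)) with hN
  have hrow : ∀ b, b ≠ topBlockCorner m n → N (topBlockCorner m n) b = 0 := by
    intro b hb
    have hb' : ((b : Fin n) : ℕ) ≠ 0 := val_ne_zero_of_ne_topBlockCorner hb
    have : ¬ ((((topBlockCorner m n : Complexity.TopBlockIdx (m + 1) n) : Fin n) : ℕ) = 0 ↔ ((b : Fin n) : ℕ) = 0) := by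
      simp [topBlockCorner, hb']
    simp only [hN, Matrix.of_apply, collapseSubst]
    rw [if_neg this]
  have hcorner : N (topBlockCorner m n) (topBlockCorner m n) = X (0, 0) := by
    simp only [hN, Matrix.of_apply]
    exact h00
  have hsub : N.submatrix (Subtype.val : {b // b ≠ topBlockCorner m n} → Complexity.TopBlockIdx (m + 1) n)
      Subtype.val = Matrix.of fun a b : {b // b ≠ topBlockCorner m n} =>
        (X (((topBlockSuccEquiv h a : BlockIdx m n) : Fin n),
            ((topBlockSuccEquiv h b : BlockIdx m n) : Fin n)) : MvPolynomial (Fin n × Fin n) k) := by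
    ext a b : 2
    have ha : ((a.1 : Fin n) : ℕ) ≠ 0 := val_ne_zero_of_ne_topBlockCorner a.2
    have hb : ((b.1 : Fin n) : ℕ) ≠ 0 := val_ne_zero_of_ne_topBlockCorner b.2
    have hiff : (((a.1 : Fin n) : ℕ) = 0 ↔ ((b.1 : Fin n) : ℕ) = 0) := by simp [ha, hb]
    simp only [Matrix.submatrix_apply, hN, Matrix.of_apply, collapseSubst]
    rw [if_pos hiff, collapseIdx_eq h a, collapseIdx_eq h b]
  have key : N.permanent = X (0, 0) *
      rename (fun ij : BlockIdx m n × BlockIdx m n => ((ij.1 : Fin n), (ij.2 : Fin n)))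
        (perPoly (BlockIdx m n) k) := by
    rw [permanent_eq_mul_of_row_eq_zero N (topBlockCorner m n) hrow, hcorner, hsub,
      ← rename_perPoly_equiv (topBlockSuccEquiv h), rename_rename]
    congr 1
    exact (rename_prodMap_perPoly_eq _).symm
  rw [Complexity.bipPaddedPerPoly, map_mul, map_pow, aeval_X, h00, aeval_rename]
  have hfun : (collapseSubst k m n ∘ fun ij : Complexity.TopBlockIdx (m + 1) n × Complexity.TopBlockIdx (m + 1) n =>
      ((ij.1 : Fin n), (ij.2 : Fin n))) = fun ij => collapseSubst k m n ((ij.1 : Fin n), (ij.2 : Fin n)) := by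
    funext ij; rfl
  rw [hfun, aeval_perPoly, ← hN, key, ← mul_assoc, ← pow_succ, paddedPerPoly]
  congr 2
  omega

/-- The tree's padded permanent `X₀₀^{n-m} · per_m` (fresh padding variable) lies in the
endomorphism orbit of BIP's padded permanent `X₀₀^{n-m-1} · per_{m+1}` of ONE SIZE LARGER
(`m + 1 ≤ n`). Over `ℂ` this gives `Δ[paddedPerPoly ℂ m n] ⊆ Z_{n,m+1}`, whence BIP's theorem at
`(n, m+1)` yields the fresh-padding variant for `n ≥ (m+1)²⁵` (module docstring).
[Bürgisser–Ikenmeyer–Panova 2019, §1.1] [folklore] -/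
theorem paddedPerPoly_mem_endOrbit_bipPaddedPerPoly_succ {m n : ℕ} [NeZero n] (h : m + 1 ≤ n) :
    paddedPerPoly k m n ∈ endOrbit (Fin n × Fin n) k (Complexity.bipPaddedPerPoly k (m + 1) n) := by
  rw [← aeval_collapseSubst_bipPaddedPerPoly h]
  exact aeval_partialRename_mem_endOrbit _ _ _

end Collapse

/-! #### Orbit-closure consequences over an infinite field -/

/-- Over an infinite field, BIP's padded permanent lies in the orbit closure of the tree's padded
permanent: `X₀₀^{n-m} per_m(top-left) ∈ Δ[X₀₀^{n-m} per_m(bottom-right)]`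
(`End · f ⊆ Δ[f]`, `endOrbit_subset_orbitClosure_holds`). [Bürgisser–Ikenmeyer–Panova 2019,
§1(a) (two padding conventions); Mulmuley–Sohoni 2001, §4] [folklore] -/
theorem bipPaddedPerPoly_mem_orbitClosure_paddedPerPoly [Infinite k] (m n : ℕ) [NeZero n] :
    Complexity.bipPaddedPerPoly k m n ∈ orbitClosure (paddedPerPoly k m n) :=
  endOrbit_subset_orbitClosure_holds (paddedPerPoly k m n)
    (bipPaddedPerPoly_mem_endOrbit_paddedPerPoly m n)

/-- Hence BIP's orbit closure `Z_{n,m}` is contained in the tree's: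
`Δ[bipPaddedPerPoly k m n] ⊆ Δ[paddedPerPoly k m n]` (transitivity
`orbitClosure_subset_of_mem_holds`). The reverse inclusion fails for `1 ≤ m < n` (`m²` versus
`m² + 1` essential variables; see `OccurrenceObstructionsBIP.lean`, §1 of the module docstring,
for the `per_1` example). [Bürgisser–Ikenmeyer–Panova 2019, §1(a)] [folklore] -/
theorem orbitClosure_bipPaddedPerPoly_subset [Infinite k] (m n : ℕ) [NeZero n] :
    orbitClosure (Complexity.bipPaddedPerPoly k m n) ⊆ orbitClosure (paddedPerPoly k m n) :=
  orbitClosure_subset_of_mem_holds (bipPaddedPerPoly_mem_orbitClosure_paddedPerPoly m n)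

/-- Over an infinite field, the tree's padded `per_m` lies in the orbit closure of BIP's padded
`per_{m+1}` (`m + 1 ≤ n`): `X₀₀^{n-m} per_m(bottom-right) ∈ Δ[X₀₀^{n-m-1} per_{m+1}(top-left)]
= Z_{n,m+1}`. [Bürgisser–Ikenmeyer–Panova 2019, §1(a)] [folklore] -/
theorem paddedPerPoly_mem_orbitClosure_bipPaddedPerPoly_succ [Infinite k] {m n : ℕ} [NeZero n]
    (h : m + 1 ≤ n) : paddedPerPoly k m n ∈ orbitClosure (Complexity.bipPaddedPerPoly k (m + 1) n) :=
  endOrbit_subset_orbitClosure_holds (Complexity.bipPaddedPerPoly k (m + 1) n)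
    (paddedPerPoly_mem_endOrbit_bipPaddedPerPoly_succ h)

/-! #### From the printed theorem to the fresh-padding variant for `n ≥ (m+1)²⁵` -/

/-- NAMED FACT (monotonicity of occurrence under degeneration, over `ℂ`): if `g' ∈ Δ[g]` then an
occurrence obstruction against `g' ∈ Δ[f]` in degree `d` is also one against `g ∈ Δ[f]`: the
restriction `ℂ[Δ[g]]_d ↠ ℂ[Δ[g']]_d` is a `GL`-equivariant surjection (in-tree:
`orbitCoordRestrict`, `orbitVanishingIdeal_le_of_mem_orbitClosure`), and by complete reducibility
of rational `GL_N(ℂ)`-modules every irreducible `W' ≤ ℂ[Δ[g']]_d` is the isomorphic image of an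
irreducible `W ≤ ℂ[Δ[g]]_d`, so that intertwiners out of `W'` factor through `W`. This is the
argument by which BIP §1(a) derive "if `λ` occurs in `ℂ[Z_{n,m}]` then it must also occur in
`ℂ[Ω_n]`" from `Z_{n,m} ⊆ Ω_n` ("restriction defines a surjective `G`-equivariant homomorphism …
Schur's lemma implies"); it needs semisimplicity, which the tree does not have (cf.
`hasMultiplicityObstruction_of_hasOccurrenceObstruction_complex`), hence a named fact.
[Bürgisser–Ikenmeyer–Panova 2019, §1(a); Bürgisser–Landsberg–Manivel–Weyman 2011, §2]
[cite: BurgisserIkenmeyerPanovaJAMS2019, §1(a) (restriction epimorphism and Schur's lemma)] -/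
def hasOccurrenceObstruction_of_mem_orbitClosure_complex : Prop :=
  ∀ {σ : Type} [Fintype σ] [DecidableEq σ] {f g g' : MvPolynomial σ ℂ} {m d : ℕ}
    (_hf : f.IsHomogeneous m) (_hg : g.IsHomogeneous m) (_h : g' ∈ orbitClosure g)
    (_hobs : HasOccurrenceObstruction f g' m d), HasOccurrenceObstruction f g m d

/-- **What the printed theorem yields for the tree's fresh-padding fact.** Granted the
monotonicity fact `hasOccurrenceObstruction_of_mem_orbitClosure_complex`, BIP's theorem AS
PRINTED (`bip2019_not_hasOccurrenceObstruction`, over `bipPaddedPerPoly`) at permanent size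
`m + 1` gives: for `1 ≤ d` and `(m+1)²⁵ ≤ n` there is no occurrence obstruction against
`paddedPerPoly ℂ m n ∈ Δ[det_n]` in degree `d` — because `paddedPerPoly ℂ m n ∈ Z_{n,m+1}`
(`paddedPerPoly_mem_orbitClosure_bipPaddedPerPoly_succ`). This is the shape of the tree's
`bip_no_occurrence_obstruction` with the threshold `m²⁵` replaced by `(m+1)²⁵`; the printed
theorem does not give the window `m²⁵ ≤ n < (m+1)²⁵`. [Bürgisser–Ikenmeyer–Panova 2019, Thm. 1.4
applied at `m + 1`] [folklore] -/
theorem not_hasOccurrenceObstruction_paddedPerPoly_of_succ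
    (h : Complexity.bip2019_not_hasOccurrenceObstruction)
    (hmono : hasOccurrenceObstruction_of_mem_orbitClosure_complex)
    (m n d : ℕ) [NeZero n] (hd : 1 ≤ d) (hn : (m + 1) ^ 25 ≤ n) :
    ¬ HasOccurrenceObstruction (detPoly (Fin n) ℂ) (paddedPerPoly ℂ m n) n d := by
  intro hobs
  have hmn : m + 1 ≤ n := le_trans (by
    calc m + 1 = (m + 1) ^ 1 := (pow_one _).symm
      _ ≤ (m + 1) ^ 25 := Nat.pow_le_pow_right (by omega) (by norm_num)) hn
  have hdet : (detPoly (Fin n) ℂ).IsHomogeneous n := by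
    simpa using detPoly_isHomogeneous (n := Fin n) (k := ℂ)
  exact h (m + 1) n d (by omega) hd hn
    (hmono hdet (Complexity.bipPaddedPerPoly_isHomogeneous hmn)
      (paddedPerPoly_mem_orbitClosure_bipPaddedPerPoly_succ hmn) hobs)

end Literature.Computability.AlgebraicComplexity
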